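import Summits.BirchSwinnertonDyer.BirchSwinnertonDyer.Theorems.SignedLowerHalvesSmallImageLowerHalfBothSignsRttJunctionShaLocCountOffP
import Summits.BirchSwinnertonDyer.BirchSwinnertonDyer.Theorems.SignedLowerHalvesSmallImageLowerHalfBothSignsRttD2SeqJ3HS2Plumb
import HarnessLib

/-!
# Route `SignedLowerHalves`, crux L `SmallImageLowerHalfBothSigns` (stmt-BirchSwinnertonDyer-23599), line `rtt_w3` v30 — stub S3α′ (`stub_junctionShaPT_ns`),
# brick α2 ASSEMBLED: `Loc = Π_{w ∈ supp(p𝔣)} 𝐇²_{Iw,w}` IS FINITE, modulo the levelwise bound AT THE PLACES ABOVE `p` (height-two / Imai-type input)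

INPUTS hand `bsd-inputs-honda-p1` g28 under LEAD `cruxlead-stmt-BirchSwinnertonDyer-23599` g14 (cell `bsd-ssimc`); helper `--supports stmt-BirchSwinnertonDyer-23599`. THEOREMS ONLY.
WHAT. ★★★ `finite_pi_semilocTwo_of_frameSupp` — for the restricted cyclotomic tower `κ_K` of the quadratic field `K`, a character `θ′` with clause (R) of `CharRoadFrameSupp S 𝔣 θ′` and
exponent `m₀ ≠ 0` on the inertia away from `p`, `𝔣 ≠ ⊥`, and ANY pinned degree-2 semilocal data `L w` (`w ∈ supp(p𝔣)`): IF at the places of `supp(p𝔣)` above `p` the levels are finite and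
uniformly bounded (hypothesis `hvp` — the height-two / Imai-type input, e.g. through part 3's `exists_bound_semilocCoh_two_of_isNonsplitIn`), THEN `Π_{w ∈ supp(p𝔣)} (L w).H` is finite —
the `Finite Loc` of the REGISTERED S3α′ for `ρ := ρ₂` (p814071). Away from `p` everything is discharged (part 3 `exists_bound_semilocCoh_two_of_frameSupp`); the limit step is LEAD g14's
`finite_pi_semiloc_of_levels` (p813183).
HONEST FRAMING: conditional on `hvp`; nothing about S3α′, E2, crux L or BSD is proved; all remain OPEN and are proved for NO curve.
References: [NeukirchSchmidtWingberg2008] (8.6.2)–(8.6.3); [PerrinRiou1994Invent] §1.3; [Imai1975] Theorem (p. 12).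
-/

set_option autoImplicit false
set_option linter.dupNamespace false -- D-0017: single-problem summit, the namespace repeats the problem name by design
noncomputable section

open scoped Classical
open NumberField IsDedekindDomain Field CategoryTheory Function

namespace Summit.BirchSwinnertonDyer.BirchSwinnertonDyer.Theorems.SmallImageRttJunctionSha

open Literature.NumberTheory.EllipticCurves Literature.NumberTheory.GaloisRepresentations Literature.NumberTheory.GaloisRepresentations.DiscreteGaloisModule
  Literature.NumberTheory.ComplexMultiplication.EllipticUnits.JohnsonLeungKings2011
  Summit.BirchSwinnertonDyer.BirchSwinnertonDyer.Theorems.SmallImageRttD2J1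
  Summit.BirchSwinnertonDyer.BirchSwinnertonDyer.Theorems.SmallImageRttD2Seq

section Pi

variable {p : ℕ} [Fact p.Prime] (hp : p ≠ 2) {κ : ZpExtension ℚ p} {K : Type} [Field K] [NumberField K] (hK2 : Module.finrank ℚ K = 2)

/-- ★★★ **α2 ASSEMBLED: `Π_{w ∈ supp(p𝔣)} 𝐇²_{Iw,w}` is finite modulo the levelwise bound above `p`.** [cite: NeukirchSchmidtWingberg2008, (8.6.2)–(8.6.3)] [cite: PerrinRiou1994Invent, §1.3]
[cite: Imai1975, Theorem (p. 12)] -/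
theorem finite_pi_semilocTwo_of_frameSupp (S : Set (PadicAlgCl p)) [FiniteDimensional ℚ_[p] (padicCoeffField S)]
    (hκ : κ.IsCyclotomic) {γ : absoluteGaloisGroup ℚ} (hγ : κ.IsTopGenerator γ) (hcv : IsCyclotomicVariable p γ)
    (θ' : absoluteGaloisGroup K →ₜ* (padicCoeffIntegers S)ˣ) {𝔣 : Ideal (𝓞 K)} (h𝔣 : 𝔣 ≠ ⊥)
    (hR : ∀ w ∈ suppPF p 𝔣, ((p : ℕ) : 𝓞 K) ∉ w.asIdeal → ∃ 𝔓 ∈ w.primesAbove, ∃ τ ∈ 𝔓.inertia (absoluteGaloisGroup K), θ' τ ≠ 1)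
    {m₀ : ℕ} (hm₀ : m₀ ≠ 0)
    (hθm : ∀ w : HeightOneSpectrum (𝓞 K), ((p : ℕ) : 𝓞 K) ∉ w.asIdeal → ∀ 𝔓 ∈ w.primesAbove, ∀ τ ∈ 𝔓.inertia (absoluteGaloisGroup K), θ' τ ^ m₀ = 1)
    (hvp : ∀ w ∈ suppPF p 𝔣, ((p : ℕ) : 𝓞 K) ∈ w.asIdeal →
      (∀ n k, Finite (semilocCoh S (κ.restrictOfFinrankEqTwo hp K hK2) θ' (suppPF p 𝔣) w n k 2)) ∧
        ∃ B : ℕ, ∀ n k, Nat.card (semilocCoh S (κ.restrictOfFinrankEqTwo hp K hK2) θ' (suppPF p 𝔣) w n k 2) ≤ B)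
    {γK : absoluteGaloisGroup K} (L : ∀ w : suppPF p 𝔣, SemilocIwasawaCohomologyDataO S (κ.restrictOfFinrankEqTwo hp K hK2) γK θ' (suppPF p 𝔣) (w : HeightOneSpectrum (𝓞 K)) 2) :
    Finite (∀ w : suppPF p 𝔣, (L w).H) := by
  have hall : ∀ w ∈ suppPF p 𝔣,
      (∀ n k, Finite (semilocCoh S (κ.restrictOfFinrankEqTwo hp K hK2) θ' (suppPF p 𝔣) w n k 2)) ∧
        ∃ B : ℕ, ∀ n k, Nat.card (semilocCoh S (κ.restrictOfFinrankEqTwo hp K hK2) θ' (suppPF p 𝔣) w n k 2) ≤ B := by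
    intro w hw
    by_cases hwp : ((p : ℕ) : 𝓞 K) ∈ w.asIdeal
    · exact hvp w hw hwp
    · exact exists_bound_semilocCoh_two_of_frameSupp hp hK2 S hκ hγ hcv θ' 𝔣 hR hm₀ hθm hw hwp
  exact finite_pi_semiloc_of_levels (SmallImageRttD2Seq.finite_suppPF_of_ne_bot h𝔣) L (fun w n k ↦ (hall w w.2).1 n k) (fun w ↦ (hall w w.2).2)

/-- **The same for -w3's CONSTRUCTED data** `L w := semilocIwasawaCohomologyDataO … w 2` (the `L₂` of `ρ₂ = semilocMapPi₂ hNP (suppPF p 𝔣) I₂ L₂`): `Finite (Π_{w : supp(p𝔣)} (L₂ w).H)` — the `Finite Loc`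
binder of the REGISTERED S3α′ with `Loc := Π_{w : supp(p𝔣)} (L₂ w).H`, modulo `hvp`. [cite: NeukirchSchmidtWingberg2008, (8.6.2)–(8.6.3)] [cite: Imai1975, Theorem (p. 12)] -/
theorem finite_pi_semilocIwasawaCohomologyDataO_two_of_frameSupp (S : Set (PadicAlgCl p)) [FiniteDimensional ℚ_[p] (padicCoeffField S)]
    (hκ : κ.IsCyclotomic) {γ : absoluteGaloisGroup ℚ} (hγ : κ.IsTopGenerator γ) (hcv : IsCyclotomicVariable p γ)
    (θ' : absoluteGaloisGroup K →ₜ* (padicCoeffIntegers S)ˣ) {𝔣 : Ideal (𝓞 K)} (h𝔣 : 𝔣 ≠ ⊥)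
    (hR : ∀ w ∈ suppPF p 𝔣, ((p : ℕ) : 𝓞 K) ∉ w.asIdeal → ∃ 𝔓 ∈ w.primesAbove, ∃ τ ∈ 𝔓.inertia (absoluteGaloisGroup K), θ' τ ≠ 1)
    {m₀ : ℕ} (hm₀ : m₀ ≠ 0)
    (hθm : ∀ w : HeightOneSpectrum (𝓞 K), ((p : ℕ) : 𝓞 K) ∉ w.asIdeal → ∀ 𝔓 ∈ w.primesAbove, ∀ τ ∈ 𝔓.inertia (absoluteGaloisGroup K), θ' τ ^ m₀ = 1)
    (hvp : ∀ w ∈ suppPF p 𝔣, ((p : ℕ) : 𝓞 K) ∈ w.asIdeal →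
      (∀ n k, Finite (semilocCoh S (κ.restrictOfFinrankEqTwo hp K hK2) θ' (suppPF p 𝔣) w n k 2)) ∧
        ∃ B : ℕ, ∀ n k, Nat.card (semilocCoh S (κ.restrictOfFinrankEqTwo hp K hK2) θ' (suppPF p 𝔣) w n k 2) ≤ B)
    (γK : absoluteGaloisGroup K) :
    Finite (∀ w : suppPF p 𝔣, (semilocIwasawaCohomologyDataO S (κ.restrictOfFinrankEqTwo hp K hK2) γK θ' (suppPF p 𝔣) (w : HeightOneSpectrum (𝓞 K)) 2).H) :=
  finite_pi_semilocTwo_of_frameSupp hp hK2 S hκ hγ hcv θ' h𝔣 hR hm₀ hθm hvp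
    (fun w ↦ semilocIwasawaCohomologyDataO S (κ.restrictOfFinrankEqTwo hp K hK2) γK θ' (suppPF p 𝔣) (w : HeightOneSpectrum (𝓞 K)) 2)

end Pi

end Summit.BirchSwinnertonDyer.BirchSwinnertonDyer.Theorems.SmallImageRttJunctionSha

end
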